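/- Fleet lead `ym-wcr-19456-p1` (seat g2), route `WeakCouplingRates`, crux `ColdBoxTwoPointFloorW` (stmt-QuantumFields-19608). -/
-- tree-module: Summits.QuantumFields.YangMills.Theorems.WeakCouplingRatesColdBoxExponents
import Mathlib.Analysis.SpecialFunctions.Pow.Asymptotics
import Mathlib.Analysis.SpecialFunctions.Pow.Real
import Mathlib.Analysis.Complex.Exponential
import HarnessLib

/-!
# Crux `ColdBoxTwoPointFloorW`, stub `stub_boxGaussianDomination`, brick R7: EXPONENT BOOKKEEPING of the one-scale expansion
# (pure real analysis)

The deterministic core bound (`…ColdBoxDominationCore`) is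
`β²c₀ + 3M²(e^{2w}−1) + 6M²p + 2τ(M+3) + √p(6M+33)` with `M = β^{6θ}`, `m = 85·β^{5θ−1/2}`, `τ = 362βm³`,
`w = P·τ + 2N·m²` (`P ≤ 155520β^{4θ}` plaquettes, `N ≤ 5184β^{4θ}` links), `p = 933120β^{4θ}e^{−β^{6θ}/8}`, `c₀ = 96e^{−β^{3θ}}` (`ε = 3θ`).
In the variables `y = β^θ ≥ 1`, `u = β^{5θ−1/2}` (so `u²β = y¹⁰`) every term is `≤ (1/5)·y^{−9}` as soon as
`5·10¹⁶·u·y³⁵ ≤ 1`, `480·β²y⁹e^{−y³} ≤ 1`, `3·10⁷·y²⁵e^{−y⁶/8} ≤ 1`, `2·10⁵·y¹⁷e^{−y⁶/16} ≤ 1` (`core_rhs_le_inv_pow`), and these four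
conditions hold eventually in `β` when `θ ≤ 1/100` (`tendsto_const_mul_rpow_mul_exp_neg`, `tendsto_const_mul_rpow_of_neg`), and the
`rpow` identities relating `β, y, u`.  No sorry; no definition; standard axioms.
-/

set_option autoImplicit false

noncomputable section

open Real Filter Topology

namespace Summit.QuantumFields.YangMills.Theorems.WeakCouplingRates

/-! ## Elementary inequalities -/

/-! ## Limits -/

/-- `C · β^s · e^{−b·β^a} → 0` (`a, b > 0`). -/
theorem tendsto_const_mul_rpow_mul_exp_neg (C s : ℝ) {a b : ℝ} (ha : 0 < a) (hb : 0 < b) :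
    Tendsto (fun β : ℝ => C * β ^ s * Real.exp (-(b * β ^ a))) atTop (𝓝 0) := by
  have h1 : Tendsto (fun β : ℝ => β ^ a) atTop atTop := tendsto_rpow_atTop ha
  have h2 := tendsto_rpow_mul_exp_neg_mul_atTop_nhds_zero (s / a) b hb
  have h3 : Tendsto (fun β : ℝ => (β ^ a) ^ (s / a) * Real.exp (-b * β ^ a)) atTop (𝓝 0) := h2.comp h1
  have h4 : Tendsto (fun β : ℝ => C * ((β ^ a) ^ (s / a) * Real.exp (-b * β ^ a))) atTop (𝓝 (C * 0)) := h3.const_mul C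
  rw [mul_zero] at h4
  refine h4.congr' ?_
  filter_upwards [eventually_gt_atTop 0] with β hβ
  rw [← Real.rpow_mul hβ.le, mul_div_cancel₀ _ ha.ne', neg_mul, mul_assoc]

/-- `C · β^{-s} → 0` (`s > 0`). -/
theorem tendsto_const_mul_rpow_of_neg (C : ℝ) {s : ℝ} (hs : 0 < s) :
    Tendsto (fun β : ℝ => C * β ^ (-s)) atTop (𝓝 0) := by
  have h := (tendsto_rpow_neg_atTop hs).const_mul C
  rwa [mul_zero] at h

/-- From a limit `0`: eventually `≤ 1`. -/
theorem eventually_le_one_of_tendsto_zero {f : ℝ → ℝ} (h : Tendsto f atTop (𝓝 0)) : ∀ᶠ β in atTop, f β ≤ 1 :=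
  h.eventually (Iic_mem_nhds zero_lt_one)

/-! ## The `rpow` dictionary `y = β^θ`, `u = β^{5θ − 1/2}` -/

/-- `u² · β = y¹⁰`. -/
theorem u_sq_mul_eq {β θ : ℝ} (hβ : 0 < β) : (β ^ (5 * θ - 1 / 2)) ^ 2 * β = (β ^ θ) ^ 10 := by
  rw [← Real.rpow_natCast (β ^ (5 * θ - 1 / 2)) 2, ← Real.rpow_mul hβ.le, ← Real.rpow_natCast (β ^ θ) 10,
    ← Real.rpow_mul hβ.le]
  conv_lhs => rw [← Real.rpow_one β, ← Real.rpow_mul hβ.le, ← Real.rpow_add hβ]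
  push_cast
  ring_nf

/-- `√(β^{6θ−1}) = u / y²`. -/
theorem sqrt_rpow_eq {β θ : ℝ} (hβ : 0 < β) : Real.sqrt (β ^ (2 * (3 * θ) - 1)) = β ^ (5 * θ - 1 / 2) / (β ^ θ) ^ 2 := by
  rw [Real.sqrt_eq_rpow, ← Real.rpow_mul hβ.le, ← Real.rpow_natCast (β ^ θ) 2, ← Real.rpow_mul hβ.le,
    ← Real.rpow_sub hβ]
  push_cast
  ring_nf

/-- `β^{2ε} = y⁶` (`ε = 3θ`). -/
theorem rpow_two_mul_three_eq {β θ : ℝ} (hβ : 0 < β) : β ^ (2 * (3 * θ)) = (β ^ θ) ^ 6 := by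
  rw [← Real.rpow_natCast (β ^ θ) 6, ← Real.rpow_mul hβ.le]; push_cast; ring_nf

/-- `β^{ε} = y³`. -/
theorem rpow_three_mul_eq {β θ : ℝ} (hβ : 0 < β) : β ^ (3 * θ) = (β ^ θ) ^ 3 := by
  rw [← Real.rpow_natCast (β ^ θ) 3, ← Real.rpow_mul hβ.le]; push_cast; ring_nf

/-- `β^{2ε−1} = u²/y⁴`. -/
theorem rpow_two_eps_sub_one_eq {β θ : ℝ} (hβ : 0 < β) : β ^ (2 * (3 * θ) - 1) = (β ^ (5 * θ - 1 / 2)) ^ 2 / (β ^ θ) ^ 4 := by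
  rw [← Real.rpow_natCast (β ^ (5 * θ - 1 / 2)) 2, ← Real.rpow_mul hβ.le, ← Real.rpow_natCast (β ^ θ) 4,
    ← Real.rpow_mul hβ.le, ← Real.rpow_sub hβ]
  push_cast
  ring_nf

/-- `√(2β) = √2 · y⁵ / u`. -/
theorem sqrt_two_mul_eq {β θ : ℝ} (hβ : 0 < β) : Real.sqrt (2 * β) = Real.sqrt 2 * (β ^ θ) ^ 5 / β ^ (5 * θ - 1 / 2) := by
  rw [Real.sqrt_mul' _ hβ.le, Real.sqrt_eq_rpow β, ← Real.rpow_natCast (β ^ θ) 5, ← Real.rpow_mul hβ.le, mul_div_assoc,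
    ← Real.rpow_sub hβ]
  push_cast
  ring_nf

/-- `β = y¹⁰/u²`. -/
theorem self_eq_div {β θ : ℝ} (hβ : 0 < β) : β = (β ^ θ) ^ 10 / (β ^ (5 * θ - 1 / 2)) ^ 2 := by
  have hu : 0 < (β ^ (5 * θ - 1 / 2)) ^ 2 := by positivity
  rw [eq_div_iff hu.ne', mul_comm, u_sq_mul_eq hβ]

/-- `β^{−9θ} = 1/y⁹`. -/
theorem rpow_neg_nine_eq {β θ : ℝ} (hβ : 0 < β) : β ^ (-(9 * θ)) = 1 / (β ^ θ) ^ 9 := by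
  rw [Real.rpow_neg hβ.le, ← Real.rpow_natCast (β ^ θ) 9, ← Real.rpow_mul hβ.le, one_div]
  push_cast; ring_nf

/-! ## The algebraic endgame -/

/-- **The core right-hand side is `≤ y^{−9}`** under the four smallness conditions (all constants explicit).  Variables: `y = β^θ ≥ 1`,
`u = β^{5θ−1/2} > 0` with `u²β = y¹⁰`; `P, N ≥ 0` the plaquette/link counts with `P ≤ 155520y⁴`, `N ≤ 5184y⁴`. -/
theorem core_rhs_le_inv_pow {β y u P N : ℝ} (hβ : 1 ≤ β) (hy : 1 ≤ y) (hu : 0 < u) (huy : u ^ 2 * β = y ^ 10)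
    (hP0 : 0 ≤ P) (hP : P ≤ 155520 * y ^ 4) (hN0 : 0 ≤ N) (hN : N ≤ 5184 * y ^ 4)
    (h7 : 5e16 * u * y ^ 35 ≤ 1) (h6 : 480 * β ^ 2 * y ^ 9 * Real.exp (-(y ^ 3)) ≤ 1)
    (h8 : 3e7 * y ^ 25 * Real.exp (-(y ^ 6 / 8)) ≤ 1) (h10 : 2e5 * y ^ 17 * Real.exp (-(y ^ 6 / 16)) ≤ 1) :
    β ^ 2 * (96 * Real.exp (-(y ^ 3))) +
        3 * (y ^ 6) ^ 2 * (Real.exp (2 * (P * (362 * β * (85 * u) ^ 3) + 2 * N * (85 * u) ^ 2)) - 1) +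
        6 * (y ^ 6) ^ 2 * (933120 * y ^ 4 * Real.exp (-((y ^ 3 / 2) ^ 2 / 2))) +
        2 * (362 * β * (85 * u) ^ 3) * (y ^ 6 + 3) +
        Real.sqrt (933120 * y ^ 4 * Real.exp (-((y ^ 3 / 2) ^ 2 / 2))) * (2 * y ^ 6 * 3 + 24 + 3 ^ 2) ≤ 1 / y ^ 9 := by
  have hy0 : 0 < y := by linarith
  have hy9 : 0 < y ^ 9 := by positivity
  have hy35 : 1 ≤ y ^ 35 := one_le_pow₀ hy
  have huy35 : u * y ^ 35 ≤ 2e-17 := by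
    have : 5e16 * u * y ^ 35 = 5e16 * (u * y ^ 35) := by ring
    rw [this] at h7
    linarith
  have hu_le : u ≤ u * y ^ 35 := le_mul_of_one_le_right hu.le hy35
  have hu1 : u ≤ 1 := by linarith
  -- the tilt size: τ = 362·85³·u·y¹⁰, m² = 7225u²
  have hτ : 362 * β * (85 * u) ^ 3 = 222313250 * u * y ^ 10 := by
    have : β * u ^ 2 = y ^ 10 := by rw [mul_comm]; exact huy
    calc 362 * β * (85 * u) ^ 3 = 222313250 * u * (β * u ^ 2) := by ring
      _ = _ := by rw [this]
  set w : ℝ := P * (362 * β * (85 * u) ^ 3) + 2 * N * (85 * u) ^ 2 with hwdef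
  have hw0 : 0 ≤ w := by rw [hwdef]; positivity
  have hy4_14 : y ^ 4 ≤ y ^ 14 := pow_le_pow_right₀ hy (by norm_num)
  have hy14_35 : y ^ 14 ≤ y ^ 35 := pow_le_pow_right₀ hy (by norm_num)
  have hwle : w ≤ 3.5e13 * (u * y ^ 14) := by
    rw [hwdef, hτ]
    have h1 : P * (222313250 * u * y ^ 10) ≤ 155520 * y ^ 4 * (222313250 * u * y ^ 10) :=
      mul_le_mul_of_nonneg_right hP (by positivity)
    have h2 : 2 * N * (85 * u) ^ 2 ≤ 2 * (5184 * y ^ 4) * (85 * u) ^ 2 :=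
      mul_le_mul_of_nonneg_right (mul_le_mul_of_nonneg_left hN (by norm_num)) (by positivity)
    have h3 : u ^ 2 ≤ u := by nlinarith
    have h4 : 2 * (5184 * y ^ 4) * (85 * u) ^ 2 = 74908800 * (y ^ 4 * u ^ 2) := by ring
    have h5 : y ^ 4 * u ^ 2 ≤ y ^ 14 * u :=
      mul_le_mul hy4_14 h3 (by positivity) (by positivity)
    have h6 : 155520 * y ^ 4 * (222313250 * u * y ^ 10) = 34574156640000 * (u * y ^ 14) := by ring
    calc P * (222313250 * u * y ^ 10) + 2 * N * (85 * u) ^ 2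
        ≤ 34574156640000 * (u * y ^ 14) + 74908800 * (y ^ 14 * u) := by
          rw [← h6]; refine add_le_add h1 (h2.trans ?_); rw [h4]; exact mul_le_mul_of_nonneg_left h5 (by norm_num)
      _ ≤ 3.5e13 * (u * y ^ 14) := by
          have : 0 ≤ u * y ^ 14 := by positivity
          nlinarith
  have huy14 : u * y ^ 14 ≤ u * y ^ 35 := mul_le_mul_of_nonneg_left hy14_35 hu.le
  have hw_half : w ≤ 1 / 2 := by linarith
  -- term 2: the tilt
  have hT2 : 3 * (y ^ 6) ^ 2 * (Real.exp (2 * w) - 1) * y ^ 9 ≤ 1 / 50 := by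
    have he : Real.exp (2 * w) - 1 ≤ 4 * w := by
      -- `|e^x − 1| ≤ 2|x|` for `|x| ≤ 1` (tree: `Balaban1983to89.B9Eq376POneLetters.exp_two_mul_sub_one_le_four_mul`)
      have h := Real.abs_exp_sub_one_le (x := 2 * w) (by rw [abs_of_nonneg (by linarith)]; linarith)
      rw [abs_of_nonneg (by linarith : (0 : ℝ) ≤ 2 * w)] at h
      have := (abs_le.1 h).2
      linarith
    calc 3 * (y ^ 6) ^ 2 * (Real.exp (2 * w) - 1) * y ^ 9 = 3 * y ^ 21 * (Real.exp (2 * w) - 1) := by ring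
      _ ≤ 3 * y ^ 21 * (4 * w) := mul_le_mul_of_nonneg_left he (by positivity)
      _ ≤ 3 * y ^ 21 * (4 * (3.5e13 * (u * y ^ 14))) := by gcongr
      _ = 4.2e14 * (u * y ^ 35) := by ring
      _ ≤ 1 / 50 := by linarith
  -- term 4: the surrogate error
  have hT4 : 2 * (362 * β * (85 * u) ^ 3) * (y ^ 6 + 3) * y ^ 9 ≤ 1 / 50 := by
    rw [hτ]
    have hy6 : y ^ 6 + 3 ≤ 4 * y ^ 6 := by nlinarith [one_le_pow₀ (n := 6) hy]
    have hy25_35 : y ^ 25 ≤ y ^ 35 := pow_le_pow_right₀ hy (by norm_num)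
    calc 2 * (222313250 * u * y ^ 10) * (y ^ 6 + 3) * y ^ 9 = 2 * 222313250 * (u * y ^ 19) * (y ^ 6 + 3) := by ring
      _ ≤ 2 * 222313250 * (u * y ^ 19) * (4 * y ^ 6) := mul_le_mul_of_nonneg_left hy6 (by positivity)
      _ = 8 * 222313250 * (u * y ^ 25) := by ring
      _ ≤ 8 * 222313250 * (u * y ^ 35) := by gcongr
      _ ≤ 1 / 50 := by linarith
  -- term 1: the large-field conditioning
  have hT1 : β ^ 2 * (96 * Real.exp (-(y ^ 3))) * y ^ 9 ≤ 1 / 5 := by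
    calc β ^ 2 * (96 * Real.exp (-(y ^ 3))) * y ^ 9 = 1 / 5 * (480 * β ^ 2 * y ^ 9 * Real.exp (-(y ^ 3))) := by ring
      _ ≤ 1 / 5 * 1 := by gcongr
      _ = 1 / 5 := by ring
  -- term 3: the Gaussian bad event
  have hexp8 : Real.exp (-((y ^ 3 / 2) ^ 2 / 2)) = Real.exp (-(y ^ 6 / 8)) := by congr 1; ring
  have hT3 : 6 * (y ^ 6) ^ 2 * (933120 * y ^ 4 * Real.exp (-((y ^ 3 / 2) ^ 2 / 2))) * y ^ 9 ≤ 1 / 5 := by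
    rw [hexp8]
    calc 6 * (y ^ 6) ^ 2 * (933120 * y ^ 4 * Real.exp (-(y ^ 6 / 8))) * y ^ 9
        = 0.186624 * (3e7 * y ^ 25 * Real.exp (-(y ^ 6 / 8))) := by ring
      _ ≤ 0.186624 * 1 := by gcongr
      _ ≤ 1 / 5 := by norm_num
  -- term 5: √p
  have hsqrt : Real.sqrt (933120 * y ^ 4 * Real.exp (-((y ^ 3 / 2) ^ 2 / 2))) ≤ 966 * y ^ 2 * Real.exp (-(y ^ 6 / 16)) := by
    rw [hexp8]
    refine (Real.sqrt_le_sqrt ?_).trans_eq (Real.sqrt_sq (by positivity))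
    have he : Real.exp (-(y ^ 6 / 16)) ^ 2 = Real.exp (-(y ^ 6 / 8)) := by
      rw [← Real.exp_nat_mul]; congr 1; push_cast; ring
    rw [mul_pow, mul_pow, he]
    have h4 : (y ^ 2) ^ 2 = y ^ 4 := by ring
    rw [h4]
    refine mul_le_mul_of_nonneg_right ?_ (Real.exp_pos _).le
    exact mul_le_mul_of_nonneg_right (by norm_num) (by positivity)
  have hT5 : Real.sqrt (933120 * y ^ 4 * Real.exp (-((y ^ 3 / 2) ^ 2 / 2))) * (2 * y ^ 6 * 3 + 24 + 3 ^ 2) * y ^ 9 ≤ 1 / 5 := by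
    have hK : 2 * y ^ 6 * 3 + 24 + 3 ^ 2 ≤ 39 * y ^ 6 := by nlinarith [one_le_pow₀ (n := 6) hy]
    have h1 : Real.sqrt (933120 * y ^ 4 * Real.exp (-((y ^ 3 / 2) ^ 2 / 2))) * (2 * y ^ 6 * 3 + 24 + 3 ^ 2) ≤
        966 * y ^ 2 * Real.exp (-(y ^ 6 / 16)) * (39 * y ^ 6) :=
      mul_le_mul hsqrt hK (by positivity) (by positivity)
    calc Real.sqrt (933120 * y ^ 4 * Real.exp (-((y ^ 3 / 2) ^ 2 / 2))) * (2 * y ^ 6 * 3 + 24 + 3 ^ 2) * y ^ 9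
        ≤ 966 * y ^ 2 * Real.exp (-(y ^ 6 / 16)) * (39 * y ^ 6) * y ^ 9 := mul_le_mul_of_nonneg_right h1 hy9.le
      _ = 0.18837 * (2e5 * y ^ 17 * Real.exp (-(y ^ 6 / 16))) := by ring
      _ ≤ 0.18837 * 1 := by gcongr
      _ ≤ 1 / 5 := by norm_num
  rw [le_div_iff₀ hy9]
  have hsplit : (β ^ 2 * (96 * Real.exp (-(y ^ 3))) +
        3 * (y ^ 6) ^ 2 * (Real.exp (2 * w) - 1) +
        6 * (y ^ 6) ^ 2 * (933120 * y ^ 4 * Real.exp (-((y ^ 3 / 2) ^ 2 / 2))) +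
        2 * (362 * β * (85 * u) ^ 3) * (y ^ 6 + 3) +
        Real.sqrt (933120 * y ^ 4 * Real.exp (-((y ^ 3 / 2) ^ 2 / 2))) * (2 * y ^ 6 * 3 + 24 + 3 ^ 2)) * y ^ 9 =
      β ^ 2 * (96 * Real.exp (-(y ^ 3))) * y ^ 9 + 3 * (y ^ 6) ^ 2 * (Real.exp (2 * w) - 1) * y ^ 9 +
        6 * (y ^ 6) ^ 2 * (933120 * y ^ 4 * Real.exp (-((y ^ 3 / 2) ^ 2 / 2))) * y ^ 9 +
        2 * (362 * β * (85 * u) ^ 3) * (y ^ 6 + 3) * y ^ 9 +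
        Real.sqrt (933120 * y ^ 4 * Real.exp (-((y ^ 3 / 2) ^ 2 / 2))) * (2 * y ^ 6 * 3 + 24 + 3 ^ 2) * y ^ 9 := by ring
  rw [hsplit]
  linarith [hT1, hT2, hT3, hT4, hT5]

end Summit.QuantumFields.YangMills.Theorems.WeakCouplingRates

end
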